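import Literature.Analysis.FluidPDE.SelfSimilarEulerVorticityCompactSupport
import HarnessLib

/-!
# Chae–Shvydkoy 2013, §4, eq. (4.2): the `L^q`-vorticity balance of a self-similar Euler profile
against smooth cut-offs (regularised, and in the limit)

Analysis/FluidPDE proof file (theorems only; no definitions, no named facts, no `sorry`): the
second step of the proof of Chae–Shvydkoy's vorticity exclusion theorem (Thm. 4.1, the tree's
named fact `chaeShvydkoy2013_vorticity_exclusion`, NOT discharged here).

* D. Chae, R. Shvydkoy, ARMA **209** (2013) = arXiv:1201.6009 [ChaeShvydkoy2013], §4, proof of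
  Thm. 4.1, eq. (4.2): "We multiply (vor) by `|ω|^{p−2}ω` and write it in the form
  `|ω|^p + (1/(p(α+1))) div(y|ω|^p) − (N/(p(α+1)))|ω|^p = (1/p) div(v|ω|^p) − ς̂|ω|^p`,
  `ς̂ = (ς ω·ω)|ω|^{−2}`", then integrated over annuli with the divergence theorem.

Here, in the tree's vocabulary (`IsSelfSimilarEulerVorticityProfile γ c U`: `U ∈ C²`,
`Ω + (V·∇)Ω = (Ω·∇)U` with `Ω = curl U`, `V = γ(y−c) + U`, `div U = 0`, so `div V = 3γ`;
`γ = 1/(α+1)`), the same identity is integrated against a COMPACTLY SUPPORTED `C¹` weight `χ`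
instead of an annulus (no surface terms), and the power `|Ω|^q` (any real `q`, also `q < 1`) is
REGULARISED as `(|Ω|² + ε)^{q/2}` so that everything is `C¹`:

1. `IsSelfSimilarEulerVorticityProfile.vorticity_rpow_balance_reg` — for `ε > 0`:
   `q ∫ χ (|Ω|²+ε)^{q/2−1}(⟪DU Ω, Ω⟫ − |Ω|²) = −3γ ∫ χ (|Ω|²+ε)^{q/2} − ∫ (|Ω|²+ε)^{q/2} Dχ·V`
   (`V·∇(|Ω|²+ε)^{q/2} = q(|Ω|²+ε)^{q/2−1}⟪(V·∇)Ω, Ω⟫` and the vorticity equation, then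
   `∫ F div(χV) + ∫ ⟪χV, ∇F⟫ = 0`);
2. `IsSelfSimilarEulerVorticityProfile.vorticity_rpow_balance` — the limit `ε → 0` for `q > 0`
   (dominated convergence on the support of `χ`):
   `(3γ − q) ∫ χ |Ω|^q + ∫ |Ω|^q Dχ·V = −q ∫ χ |Ω|^{q−2} ⟪DU Ω, Ω⟫`
   (with `|Ω|^{q−2}⟪DU Ω, Ω⟫ = 0` where `Ω = 0`, as `0^{q−2} = 0` in Mathlib's `rpow` for `q ≠ 2`
   and the inner product vanishes anyway) — this is (4.2) integrated against `χ`: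
   `(N/(p(α+1)) − 1)·p = 3γ·… ` with `N = 3`, `p = q`.

The remaining steps of Thm. 4.1 (choice of `χ` = exterior annular cut-offs, the sign of `Dχ·V` from
`SelfSimilarEulerRadialVelocity.lean`, absorption of `ς̂` for `|y| ≥ R`, `Ω = 0` near infinity,
then `curl_eq_zero_of_hasCompactSupport` and a harmonic Liouville argument) are not in this file.

## Mathlib / tree search

Reused: `contDiff_curl` (`VorticityCalculus`), `divergence_selfSimilarTransport`,
`IsSelfSimilarEulerVorticityProfile.vorticity_eq` (`SelfSimilarEulerProfile{,Vorticity}`),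
`integral_mul_divergence_add_eq_zero_right`, `divergence_smul_apply` (`WholeSpaceIBP`); Mathlib
`HasFDerivAt.norm_sq`, `HasFDerivAt.rpow_const`, `ContDiff.rpow_const_of_ne`,
`tendsto_integral_of_dominated_convergence`, `Filter.Tendsto.rpow_const`,
`tendsto_one_div_add_atTop_nhds_zero_nat`. No new definitions, no instances, no notation.
-/

noncomputable section

open MeasureTheory Set Filter Topology Metric InnerProductSpace
open scoped RealInnerProductSpace

namespace Literature.Analysis.FluidPDE

/-- `⟪∇θ(y), v⟫ = Dθ(y) v`. [folklore] -/
private theorem inner_gradient_eq_fderiv_vb {θ : EuclideanSpace ℝ (Fin 3) → ℝ}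
    (y v : EuclideanSpace ℝ (Fin 3)) : ⟪gradient θ y, v⟫ = fderiv ℝ θ y v := by
  rw [gradient, InnerProductSpace.toDual_symm_apply]

/-- **The regularised `L^q`-vorticity balance** (CS13 (4.2) with `|ω|^p` replaced by
`(|Ω|²+ε)^{q/2}`, integrated against a compactly supported `C¹` weight `χ`): for a vorticity-form
profile, any real `q`, `ε > 0`,
`q ∫ χ (|Ω|²+ε)^{q/2−1}(⟪DU Ω, Ω⟫ − |Ω|²) = −3γ ∫ χ (|Ω|²+ε)^{q/2} − ∫ (|Ω|²+ε)^{q/2} Dχ(V)`,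
`Ω = curl U`, `V = γ(y−c) + U`. [cite: ChaeShvydkoy2013, §4 proof of Thm. 4.1, eq. (4.2)] -/
theorem IsSelfSimilarEulerVorticityProfile.vorticity_rpow_balance_reg {γ : ℝ}
    {c : EuclideanSpace ℝ (Fin 3)} {U : EuclideanSpace ℝ (Fin 3) → EuclideanSpace ℝ (Fin 3)}
    (h : IsSelfSimilarEulerVorticityProfile γ c U) (q : ℝ) {ε : ℝ} (hε : 0 < ε)
    {χ : EuclideanSpace ℝ (Fin 3) → ℝ} (hχ : ContDiff ℝ 1 χ) (hχc : HasCompactSupport χ) :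
    q * ∫ y, χ y * ((‖curl U y‖ ^ 2 + ε) ^ (q / 2 - 1) *
        (⟪fderiv ℝ U y (curl U y), curl U y⟫ - ‖curl U y‖ ^ 2)) =
      -(3 * γ) * (∫ y, χ y * (‖curl U y‖ ^ 2 + ε) ^ (q / 2)) -
        ∫ y, (‖curl U y‖ ^ 2 + ε) ^ (q / 2) * fderiv ℝ χ y (selfSimilarTransport γ c U y) := by
  have hU2 : ContDiff ℝ 2 U := h.contDiff_velocity
  have hU1 : ContDiff ℝ 1 U := hU2.of_le one_le_two
  have hUc : Continuous U := hU1.continuous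
  have hDUc : Continuous (fderiv ℝ U) := hU1.continuous_fderiv one_ne_zero
  have hω1 : ContDiff ℝ 1 (curl U) := contDiff_curl (n := 1) (by exact_mod_cast hU2)
  have hωc : Continuous (curl U) := hω1.continuous
  have hDωc : Continuous (fderiv ℝ (curl U)) := hω1.continuous_fderiv one_ne_zero
  have hχcont : Continuous χ := hχ.continuous
  have hDχc : Continuous (fderiv ℝ χ) := hχ.continuous_fderiv one_ne_zero
  -- the transport field
  have hV1 : ContDiff ℝ 1 (selfSimilarTransport γ c U) := by
    have : selfSimilarTransport γ c U = fun y => γ • (y - c) + U y := by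
      funext y; rw [selfSimilarTransport_apply]
    rw [this]
    exact ((contDiff_id.sub contDiff_const).const_smul γ).add hU1
  have hVc : Continuous (selfSimilarTransport γ c U) := hV1.continuous
  have hdivV : ∀ y, VectorCalculus.divergence (selfSimilarTransport γ c U) y = 3 * γ :=
    fun y => divergence_selfSimilarTransport (hU1.differentiable one_ne_zero) h.divFree y
  -- the regularised power `F = (|Ω|² + ε)^{q/2}`
  have hpos : ∀ y, 0 < ‖curl U y‖ ^ 2 + ε := fun y => by positivity
  have hF1 : ContDiff ℝ 1 (fun y => (‖curl U y‖ ^ 2 + ε) ^ (q / 2)) :=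
    ((hω1.norm_sq ℝ).add contDiff_const).rpow_const_of_ne fun y => (hpos y).ne'
  have hFc : Continuous (fun y => (‖curl U y‖ ^ 2 + ε) ^ (q / 2)) := hF1.continuous
  -- its derivative along `V`, via the vorticity equation
  have hDF : ∀ y, fderiv ℝ (fun y => (‖curl U y‖ ^ 2 + ε) ^ (q / 2)) y
      (selfSimilarTransport γ c U y) = q * ((‖curl U y‖ ^ 2 + ε) ^ (q / 2 - 1) *
        (⟪fderiv ℝ U y (curl U y), curl U y⟫ - ‖curl U y‖ ^ 2)) := by
    intro y
    have hω := ((hω1.differentiable one_ne_zero) y).hasFDerivAt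
    have h1 : HasFDerivAt (fun y => ‖curl U y‖ ^ 2 + ε)
        ((2 : ℕ) • (innerSL ℝ (curl U y)).comp (fderiv ℝ (curl U) y)) y := by
      simpa using hω.norm_sq.add_const ε
    have h2 := h1.rpow_const (p := q / 2) (Or.inl (hpos y).ne')
    have hveq := h.vorticity_eq y
    rw [← selfSimilarTransport_apply] at hveq
    have hD : fderiv ℝ (curl U) y (selfSimilarTransport γ c U y) =
        fderiv ℝ U y (curl U y) - curl U y := by
      rw [← hveq]; abel
    rw [h2.fderiv, smul_apply, smul_apply, ContinuousLinearMap.comp_apply, innerSL_apply_apply,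
      hD, inner_sub_right, real_inner_self_eq_norm_sq, real_inner_comm, smul_eq_mul, nsmul_eq_mul]
    push_cast
    ring
  -- integration by parts: `∫ F div(χV) + ∫ ⟪χV, ∇F⟫ = 0`
  have hχV1 : ContDiff ℝ 1 (fun y => χ y • selfSimilarTransport γ c U y) := hχ.smul hV1
  have hχVc : HasCompactSupport (fun y => χ y • selfSimilarTransport γ c U y) := hχc.smul_right
  have hIBP := integral_mul_divergence_add_eq_zero_right hF1 hχV1 hχVc
  have hdiv : ∀ y, VectorCalculus.divergence (fun y => χ y • selfSimilarTransport γ c U y) y =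
      χ y * (3 * γ) + fderiv ℝ χ y (selfSimilarTransport γ c U y) := by
    intro y
    rw [divergence_smul_apply ((hχ.differentiable one_ne_zero) y)
      ((hV1.differentiable one_ne_zero) y), hdivV, real_inner_comm, inner_gradient_eq_fderiv_vb]
  have hinner : ∀ y, ⟪χ y • selfSimilarTransport γ c U y,
      gradient (fun y => (‖curl U y‖ ^ 2 + ε) ^ (q / 2)) y⟫ =
      χ y * (q * ((‖curl U y‖ ^ 2 + ε) ^ (q / 2 - 1) *
        (⟪fderiv ℝ U y (curl U y), curl U y⟫ - ‖curl U y‖ ^ 2))) := by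
    intro y
    rw [inner_smul_left, real_inner_comm, inner_gradient_eq_fderiv_vb, hDF]
    simp
  simp_rw [hdiv, hinner] at hIBP
  -- split the integrals
  have hi1 : Integrable (fun y => (‖curl U y‖ ^ 2 + ε) ^ (q / 2) * (χ y * (3 * γ)))
      (volume : Measure (EuclideanSpace ℝ (Fin 3))) :=
    (hFc.mul (hχcont.mul continuous_const)).integrable_of_hasCompactSupport
      (hχc.mul_right.mul_left)
  have hi2 : Integrable (fun y => (‖curl U y‖ ^ 2 + ε) ^ (q / 2) *
      fderiv ℝ χ y (selfSimilarTransport γ c U y)) (volume : Measure (EuclideanSpace ℝ (Fin 3))) := by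
    refine (hFc.mul (hDχc.clm_apply hVc)).integrable_of_hasCompactSupport ?_
    refine ((hχc.fderiv (𝕜 := ℝ)).mono fun y hy => ?_).mul_left
    contrapose! hy
    simp only [Function.mem_support, not_not] at hy ⊢
    simp [hy]
  have hi3 : Integrable (fun y => χ y * (q * ((‖curl U y‖ ^ 2 + ε) ^ (q / 2 - 1) *
      (⟪fderiv ℝ U y (curl U y), curl U y⟫ - ‖curl U y‖ ^ 2))))
      (volume : Measure (EuclideanSpace ℝ (Fin 3))) := by
    refine (hχcont.mul (continuous_const.mul (?_ : Continuous _))).integrable_of_hasCompactSupport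
      hχc.mul_right
    refine (Continuous.rpow_const (hωc.norm.pow 2 |>.add continuous_const) fun y =>
      Or.inl (hpos y).ne').mul ?_
    exact ((hDUc.clm_apply hωc).inner hωc).sub (hωc.norm.pow 2)
  have e1 : ∫ y, (‖curl U y‖ ^ 2 + ε) ^ (q / 2) * (χ y * (3 * γ) +
      fderiv ℝ χ y (selfSimilarTransport γ c U y)) =
      (3 * γ) * (∫ y, χ y * (‖curl U y‖ ^ 2 + ε) ^ (q / 2)) +
        ∫ y, (‖curl U y‖ ^ 2 + ε) ^ (q / 2) * fderiv ℝ χ y (selfSimilarTransport γ c U y) := by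
    have : (fun y => (‖curl U y‖ ^ 2 + ε) ^ (q / 2) * (χ y * (3 * γ) +
        fderiv ℝ χ y (selfSimilarTransport γ c U y))) = fun y =>
        (‖curl U y‖ ^ 2 + ε) ^ (q / 2) * (χ y * (3 * γ)) +
          (‖curl U y‖ ^ 2 + ε) ^ (q / 2) * fderiv ℝ χ y (selfSimilarTransport γ c U y) := by
      funext y; ring
    rw [this, integral_add hi1 hi2, ← integral_const_mul]
    congr 1
    refine integral_congr_ae (Eventually.of_forall fun y => ?_)
    simp only
    ring
  have e2 : ∫ y, χ y * (q * ((‖curl U y‖ ^ 2 + ε) ^ (q / 2 - 1) *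
      (⟪fderiv ℝ U y (curl U y), curl U y⟫ - ‖curl U y‖ ^ 2))) =
      q * ∫ y, χ y * ((‖curl U y‖ ^ 2 + ε) ^ (q / 2 - 1) *
        (⟪fderiv ℝ U y (curl U y), curl U y⟫ - ‖curl U y‖ ^ 2)) := by
    rw [← integral_const_mul]
    refine integral_congr_ae (Eventually.of_forall fun y => ?_)
    simp only
    ring
  rw [e1, e2] at hIBP
  linarith

/-- **The `L^q`-vorticity balance, `q > 0`** (CS13 (4.2) integrated against a compactly supported
`C¹` weight; the limit `ε → 0` of the regularised balance by dominated convergence on the support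
of `χ`): `(3γ − q) ∫ χ|Ω|^q + ∫ |Ω|^q Dχ(V) = −q ∫ χ |Ω|^{q−2}⟪DU Ω, Ω⟫`.
[cite: ChaeShvydkoy2013, §4 proof of Thm. 4.1, eq. (4.2)] -/
theorem IsSelfSimilarEulerVorticityProfile.vorticity_rpow_balance {γ : ℝ}
    {c : EuclideanSpace ℝ (Fin 3)} {U : EuclideanSpace ℝ (Fin 3) → EuclideanSpace ℝ (Fin 3)}
    (h : IsSelfSimilarEulerVorticityProfile γ c U) {q : ℝ} (hq : 0 < q)
    {χ : EuclideanSpace ℝ (Fin 3) → ℝ} (hχ : ContDiff ℝ 1 χ) (hχc : HasCompactSupport χ) :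
    (3 * γ - q) * (∫ y, χ y * ‖curl U y‖ ^ q) +
        ∫ y, ‖curl U y‖ ^ q * fderiv ℝ χ y (selfSimilarTransport γ c U y) =
      -q * ∫ y, χ y * (‖curl U y‖ ^ (q - 2) * ⟪fderiv ℝ U y (curl U y), curl U y⟫) := by
  have hU2 : ContDiff ℝ 2 U := h.contDiff_velocity
  have hU1 : ContDiff ℝ 1 U := hU2.of_le one_le_two
  have hUc : Continuous U := hU1.continuous
  have hDUc : Continuous (fderiv ℝ U) := hU1.continuous_fderiv one_ne_zero
  have hω1 : ContDiff ℝ 1 (curl U) := contDiff_curl (n := 1) (by exact_mod_cast hU2)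
  have hωc : Continuous (curl U) := hω1.continuous
  have hχcont : Continuous χ := hχ.continuous
  have hDχc : Continuous (fderiv ℝ χ) := hχ.continuous_fderiv one_ne_zero
  have hV1 : ContDiff ℝ 1 (selfSimilarTransport γ c U) := by
    have : selfSimilarTransport γ c U = fun y => γ • (y - c) + U y := by
      funext y; rw [selfSimilarTransport_apply]
    rw [this]
    exact ((contDiff_id.sub contDiff_const).const_smul γ).add hU1
  have hVc : Continuous (selfSimilarTransport γ c U) := hV1.continuous
  have hDχsupp : HasCompactSupport (fun y => fderiv ℝ χ y (selfSimilarTransport γ c U y)) :=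
    (hχc.fderiv (𝕜 := ℝ)).mono fun y hy => by
      contrapose! hy
      simp only [Function.mem_support, not_not] at hy ⊢
      simp [hy]
  -- the sequence `ε_n = 1/(n+1)`
  set ε : ℕ → ℝ := fun n => 1 / ((n : ℝ) + 1) with hε_def
  have hε0 : ∀ n, 0 < ε n := fun n => by rw [hε_def]; positivity
  have hε1 : ∀ n, ε n ≤ 1 := fun n => by
    rw [hε_def, div_le_one (by positivity)]; linarith [n.cast_nonneg (α := ℝ)]
  have hεlim : Tendsto ε atTop (𝓝 0) := tendsto_one_div_add_atTop_nhds_zero_nat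
  -- the regularised identities
  have hreg : ∀ n, q * ∫ y, χ y * ((‖curl U y‖ ^ 2 + ε n) ^ (q / 2 - 1) *
      (⟪fderiv ℝ U y (curl U y), curl U y⟫ - ‖curl U y‖ ^ 2)) =
      -(3 * γ) * (∫ y, χ y * (‖curl U y‖ ^ 2 + ε n) ^ (q / 2)) -
        ∫ y, (‖curl U y‖ ^ 2 + ε n) ^ (q / 2) * fderiv ℝ χ y (selfSimilarTransport γ c U y) :=
    fun n => h.vorticity_rpow_balance_reg q (hε0 n) hχ hχc
  -- pointwise limits
  have hbase : ∀ y, Tendsto (fun n => ‖curl U y‖ ^ 2 + ε n) atTop (𝓝 (‖curl U y‖ ^ 2)) :=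
    fun y => by simpa using (tendsto_const_nhds (x := ‖curl U y‖ ^ 2)).add hεlim
  have hpowq : ∀ y, (‖curl U y‖ ^ 2) ^ (q / 2) = ‖curl U y‖ ^ q := fun y => by
    rw [← Real.rpow_natCast, ← Real.rpow_mul (norm_nonneg _)]
    congr 1; push_cast; ring
  have hlimA : ∀ y, Tendsto (fun n => χ y * ((‖curl U y‖ ^ 2 + ε n) ^ (q / 2 - 1) *
      (⟪fderiv ℝ U y (curl U y), curl U y⟫ - ‖curl U y‖ ^ 2))) atTop
      (𝓝 (χ y * (‖curl U y‖ ^ (q - 2) * ⟪fderiv ℝ U y (curl U y), curl U y⟫ -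
        ‖curl U y‖ ^ q))) := by
    intro y
    by_cases hω : curl U y = 0
    · simp only [hω, map_zero, inner_zero_right, norm_zero, ne_eq, OfNat.ofNat_ne_zero,
        not_false_eq_true, zero_pow, sub_self, mul_zero, Real.zero_rpow hq.ne']
      exact tendsto_const_nhds
    · have hn : ‖curl U y‖ ^ 2 ≠ 0 := by positivity
      have h1 := (hbase y).rpow_const (p := q / 2 - 1) (Or.inl hn)
      have e : (‖curl U y‖ ^ 2) ^ (q / 2 - 1) = ‖curl U y‖ ^ (q - 2) := by
        rw [← Real.rpow_natCast, ← Real.rpow_mul (norm_nonneg _)]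
        congr 1; push_cast; ring
      rw [e] at h1
      have e2 : χ y * (‖curl U y‖ ^ (q - 2) * ⟪fderiv ℝ U y (curl U y), curl U y⟫ -
          ‖curl U y‖ ^ q) = χ y * (‖curl U y‖ ^ (q - 2) *
          (⟪fderiv ℝ U y (curl U y), curl U y⟫ - ‖curl U y‖ ^ 2)) := by
        have : ‖curl U y‖ ^ q = ‖curl U y‖ ^ (q - 2) * ‖curl U y‖ ^ 2 := by
          rw [← Real.rpow_natCast ‖curl U y‖ 2,
            ← Real.rpow_add (norm_pos_iff.2 hω)]
          congr 1; push_cast; ring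
        rw [this]; ring
      rw [e2]
      exact (h1.mul tendsto_const_nhds).const_mul _
  have hlimB : ∀ y, Tendsto (fun n => (‖curl U y‖ ^ 2 + ε n) ^ (q / 2) *
      ((3 * γ) * χ y + fderiv ℝ χ y (selfSimilarTransport γ c U y))) atTop
      (𝓝 (‖curl U y‖ ^ q * ((3 * γ) * χ y + fderiv ℝ χ y (selfSimilarTransport γ c U y)))) := by
    intro y
    have h1 := (hbase y).rpow_const (p := q / 2) (Or.inr (by positivity))
    rw [hpowq] at h1
    exact h1.mul tendsto_const_nhds
  -- dominations on the support of `χ`, `Dχ`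
  have hdomA : ∀ n y, ‖χ y * ((‖curl U y‖ ^ 2 + ε n) ^ (q / 2 - 1) *
      (⟪fderiv ℝ U y (curl U y), curl U y⟫ - ‖curl U y‖ ^ 2))‖ ≤
      |χ y| * ((‖fderiv ℝ U y‖ + 1) * (‖curl U y‖ ^ 2 + 1) ^ (q / 2)) := by
    intro n y
    have hb : 0 < ‖curl U y‖ ^ 2 + ε n := by have := hε0 n; positivity
    rw [Real.norm_eq_abs, abs_mul, abs_mul]
    refine mul_le_mul_of_nonneg_left ?_ (abs_nonneg _)
    have h1 : |⟪fderiv ℝ U y (curl U y), curl U y⟫ - ‖curl U y‖ ^ 2| ≤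
        (‖fderiv ℝ U y‖ + 1) * ‖curl U y‖ ^ 2 := by
      calc |⟪fderiv ℝ U y (curl U y), curl U y⟫ - ‖curl U y‖ ^ 2|
          ≤ |⟪fderiv ℝ U y (curl U y), curl U y⟫| + |‖curl U y‖ ^ 2| := abs_sub _ _
        _ ≤ ‖fderiv ℝ U y‖ * ‖curl U y‖ * ‖curl U y‖ + ‖curl U y‖ ^ 2 := by
            rw [abs_of_nonneg (by positivity : (0:ℝ) ≤ ‖curl U y‖ ^ 2)]
            refine add_le_add ((abs_real_inner_le_norm _ _).trans ?_) le_rfl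
            exact mul_le_mul_of_nonneg_right (ContinuousLinearMap.le_opNorm _ _) (norm_nonneg _)
        _ = (‖fderiv ℝ U y‖ + 1) * ‖curl U y‖ ^ 2 := by ring
    have h2 : (‖curl U y‖ ^ 2 + ε n) ^ (q / 2 - 1) * ‖curl U y‖ ^ 2 ≤
        (‖curl U y‖ ^ 2 + 1) ^ (q / 2) := by
      calc (‖curl U y‖ ^ 2 + ε n) ^ (q / 2 - 1) * ‖curl U y‖ ^ 2
          ≤ (‖curl U y‖ ^ 2 + ε n) ^ (q / 2 - 1) * (‖curl U y‖ ^ 2 + ε n) :=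
            mul_le_mul_of_nonneg_left (by linarith [hε0 n]) (Real.rpow_nonneg hb.le _)
        _ = (‖curl U y‖ ^ 2 + ε n) ^ (q / 2) := by
            rw [← Real.rpow_add_one hb.ne']; congr 1; ring
        _ ≤ (‖curl U y‖ ^ 2 + 1) ^ (q / 2) :=
            Real.rpow_le_rpow hb.le (by linarith [hε1 n]) (by positivity)
    rw [abs_of_nonneg (Real.rpow_nonneg hb.le _)]
    calc (‖curl U y‖ ^ 2 + ε n) ^ (q / 2 - 1) * |⟪fderiv ℝ U y (curl U y), curl U y⟫ -
          ‖curl U y‖ ^ 2|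
        ≤ (‖curl U y‖ ^ 2 + ε n) ^ (q / 2 - 1) * ((‖fderiv ℝ U y‖ + 1) * ‖curl U y‖ ^ 2) :=
          mul_le_mul_of_nonneg_left h1 (Real.rpow_nonneg hb.le _)
      _ = (‖fderiv ℝ U y‖ + 1) * ((‖curl U y‖ ^ 2 + ε n) ^ (q / 2 - 1) * ‖curl U y‖ ^ 2) := by
          ring
      _ ≤ (‖fderiv ℝ U y‖ + 1) * (‖curl U y‖ ^ 2 + 1) ^ (q / 2) :=
          mul_le_mul_of_nonneg_left h2 (by positivity)
  have hdomB : ∀ n y, ‖(‖curl U y‖ ^ 2 + ε n) ^ (q / 2) *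
      ((3 * γ) * χ y + fderiv ℝ χ y (selfSimilarTransport γ c U y))‖ ≤
      (‖curl U y‖ ^ 2 + 1) ^ (q / 2) * |(3 * γ) * χ y + fderiv ℝ χ y
        (selfSimilarTransport γ c U y)| := by
    intro n y
    have hb : 0 < ‖curl U y‖ ^ 2 + ε n := by have := hε0 n; positivity
    rw [Real.norm_eq_abs, abs_mul, abs_of_nonneg (Real.rpow_nonneg hb.le _)]
    exact mul_le_mul_of_nonneg_right
      (Real.rpow_le_rpow hb.le (by linarith [hε1 n]) (by positivity)) (abs_nonneg _)
  -- integrability of the dominating functions (continuous, compactly supported)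
  have hq2c : Continuous fun y : EuclideanSpace ℝ (Fin 3) => (‖curl U y‖ ^ 2 + 1) ^ (q / 2) :=
    Continuous.rpow_const (hωc.norm.pow 2 |>.add continuous_const) fun y =>
      Or.inl (by positivity)
  have hbiA : Integrable (fun y => |χ y| * ((‖fderiv ℝ U y‖ + 1) * (‖curl U y‖ ^ 2 + 1) ^ (q / 2)))
      (volume : Measure (EuclideanSpace ℝ (Fin 3))) :=
    (hχcont.abs.mul ((hDUc.norm.add continuous_const).mul hq2c)).integrable_of_hasCompactSupport
      (hχc.norm.mul_right)
  have hbiB : Integrable (fun y => (‖curl U y‖ ^ 2 + 1) ^ (q / 2) * |(3 * γ) * χ y +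
      fderiv ℝ χ y (selfSimilarTransport γ c U y)|) (volume : Measure (EuclideanSpace ℝ (Fin 3))) :=
    (hq2c.mul ((continuous_const.mul hχcont).add (hDχc.clm_apply hVc)).abs)
      |>.integrable_of_hasCompactSupport ((hχc.mul_left.add hDχsupp).norm.mul_left)
  -- measurability of the approximants
  have hmeasA : ∀ n, AEStronglyMeasurable (fun y => χ y * ((‖curl U y‖ ^ 2 + ε n) ^ (q / 2 - 1) *
      (⟪fderiv ℝ U y (curl U y), curl U y⟫ - ‖curl U y‖ ^ 2)))
      (volume : Measure (EuclideanSpace ℝ (Fin 3))) := by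
    intro n
    refine (hχcont.mul ((Continuous.rpow_const (hωc.norm.pow 2 |>.add continuous_const) fun y =>
      Or.inl (add_pos_of_nonneg_of_pos (sq_nonneg _) (hε0 n)).ne').mul ?_)).aestronglyMeasurable
    exact ((hDUc.clm_apply hωc).inner hωc).sub (hωc.norm.pow 2)
  have hmeasB : ∀ n, AEStronglyMeasurable (fun y => (‖curl U y‖ ^ 2 + ε n) ^ (q / 2) *
      ((3 * γ) * χ y + fderiv ℝ χ y (selfSimilarTransport γ c U y)))
      (volume : Measure (EuclideanSpace ℝ (Fin 3))) := by
    intro n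
    refine ((Continuous.rpow_const (hωc.norm.pow 2 |>.add continuous_const) fun y =>
      Or.inl (add_pos_of_nonneg_of_pos (sq_nonneg _) (hε0 n)).ne').mul
      ((continuous_const.mul hχcont).add (hDχc.clm_apply hVc))).aestronglyMeasurable
  -- dominated convergence
  have hA := tendsto_integral_of_dominated_convergence _ hmeasA hbiA
    (fun n => Eventually.of_forall (hdomA n)) (Eventually.of_forall hlimA)
  have hB := tendsto_integral_of_dominated_convergence _ hmeasB hbiB
    (fun n => Eventually.of_forall (hdomB n)) (Eventually.of_forall hlimB)
  -- rewrite the regularised identities as `q · A_n = −B_n` and pass to the limit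
  have hregB : ∀ n, -(3 * γ) * (∫ y, χ y * (‖curl U y‖ ^ 2 + ε n) ^ (q / 2)) -
      ∫ y, (‖curl U y‖ ^ 2 + ε n) ^ (q / 2) * fderiv ℝ χ y (selfSimilarTransport γ c U y) =
      -∫ y, (‖curl U y‖ ^ 2 + ε n) ^ (q / 2) *
        ((3 * γ) * χ y + fderiv ℝ χ y (selfSimilarTransport γ c U y)) := by
    intro n
    have hFc : Continuous (fun y => (‖curl U y‖ ^ 2 + ε n) ^ (q / 2)) :=
      Continuous.rpow_const (hωc.norm.pow 2 |>.add continuous_const) fun y =>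
        Or.inl (add_pos_of_nonneg_of_pos (sq_nonneg _) (hε0 n)).ne'
    have hi1 : Integrable (fun y => (‖curl U y‖ ^ 2 + ε n) ^ (q / 2) * ((3 * γ) * χ y))
        (volume : Measure (EuclideanSpace ℝ (Fin 3))) :=
      (hFc.mul (continuous_const.mul hχcont)).integrable_of_hasCompactSupport
        (hχc.mul_left.mul_left)
    have hi2 : Integrable (fun y => (‖curl U y‖ ^ 2 + ε n) ^ (q / 2) *
        fderiv ℝ χ y (selfSimilarTransport γ c U y))
        (volume : Measure (EuclideanSpace ℝ (Fin 3))) :=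
      (hFc.mul (hDχc.clm_apply hVc)).integrable_of_hasCompactSupport hDχsupp.mul_left
    have e : (fun y => (‖curl U y‖ ^ 2 + ε n) ^ (q / 2) *
        ((3 * γ) * χ y + fderiv ℝ χ y (selfSimilarTransport γ c U y))) = fun y =>
        (‖curl U y‖ ^ 2 + ε n) ^ (q / 2) * ((3 * γ) * χ y) +
          (‖curl U y‖ ^ 2 + ε n) ^ (q / 2) * fderiv ℝ χ y (selfSimilarTransport γ c U y) := by
      funext y; ring
    rw [e, integral_add hi1 hi2]
    have e2 : ∫ y, (‖curl U y‖ ^ 2 + ε n) ^ (q / 2) * ((3 * γ) * χ y) =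
        (3 * γ) * ∫ y, χ y * (‖curl U y‖ ^ 2 + ε n) ^ (q / 2) := by
      rw [← integral_const_mul]
      refine integral_congr_ae (Eventually.of_forall fun y => ?_)
      simp only
      ring
    rw [e2]
    ring
  have hseq : ∀ n, q * (∫ y, χ y * ((‖curl U y‖ ^ 2 + ε n) ^ (q / 2 - 1) *
      (⟪fderiv ℝ U y (curl U y), curl U y⟫ - ‖curl U y‖ ^ 2))) =
      -∫ y, (‖curl U y‖ ^ 2 + ε n) ^ (q / 2) *
        ((3 * γ) * χ y + fderiv ℝ χ y (selfSimilarTransport γ c U y)) := fun n => by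
    rw [hreg n, hregB n]
  have hlim1 : Tendsto (fun n => q * (∫ y, χ y * ((‖curl U y‖ ^ 2 + ε n) ^ (q / 2 - 1) *
      (⟪fderiv ℝ U y (curl U y), curl U y⟫ - ‖curl U y‖ ^ 2)))) atTop
      (𝓝 (q * ∫ y, (χ y * (‖curl U y‖ ^ (q - 2) * ⟪fderiv ℝ U y (curl U y), curl U y⟫ -
        ‖curl U y‖ ^ q)))) := hA.const_mul q
  have hlim2 : Tendsto (fun n => -∫ y, (‖curl U y‖ ^ 2 + ε n) ^ (q / 2) *
      ((3 * γ) * χ y + fderiv ℝ χ y (selfSimilarTransport γ c U y))) atTop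
      (𝓝 (-∫ y, ‖curl U y‖ ^ q * ((3 * γ) * χ y + fderiv ℝ χ y
        (selfSimilarTransport γ c U y)))) := hB.neg
  have heq := tendsto_nhds_unique (hlim1.congr hseq) hlim2
  -- unpack the limit identity
  have hωq : Continuous fun y => ‖curl U y‖ ^ q :=
    hωc.norm.rpow_const fun y => Or.inr hq.le
  have hiL1 : Integrable (fun y => χ y * ‖curl U y‖ ^ q)
      (volume : Measure (EuclideanSpace ℝ (Fin 3))) :=
    (hχcont.mul hωq).integrable_of_hasCompactSupport hχc.mul_right
  have hiL2 : Integrable (fun y => ‖curl U y‖ ^ q * fderiv ℝ χ y (selfSimilarTransport γ c U y))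
      (volume : Measure (EuclideanSpace ℝ (Fin 3))) :=
    (hωq.mul (hDχc.clm_apply hVc)).integrable_of_hasCompactSupport hDχsupp.mul_left
  have hiL3 : Integrable (fun y => χ y * (‖curl U y‖ ^ (q - 2) *
      ⟪fderiv ℝ U y (curl U y), curl U y⟫)) (volume : Measure (EuclideanSpace ℝ (Fin 3))) := by
    -- the limit of integrable functions dominated by an integrable bound is integrable:
    -- here directly, `|χ| |Ω|^{q-2} |⟪DUΩ,Ω⟫| ≤ |χ| ‖DU‖ |Ω|^q`, a continuous compactly supported
    -- bound; measurability from the a.e. limit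
    have hmeas : AEStronglyMeasurable (fun y => χ y * (‖curl U y‖ ^ (q - 2) *
        ⟪fderiv ℝ U y (curl U y), curl U y⟫)) (volume : Measure (EuclideanSpace ℝ (Fin 3))) := by
      have h1 : AEStronglyMeasurable (fun y => χ y * (‖curl U y‖ ^ (q - 2) *
          ⟪fderiv ℝ U y (curl U y), curl U y⟫ - ‖curl U y‖ ^ q))
          (volume : Measure (EuclideanSpace ℝ (Fin 3))) :=
        aestronglyMeasurable_of_tendsto_ae atTop hmeasA (Eventually.of_forall hlimA)
      have h2 : AEStronglyMeasurable (fun y => χ y * ‖curl U y‖ ^ q)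
          (volume : Measure (EuclideanSpace ℝ (Fin 3))) := hiL1.1
      refine (h1.add h2).congr (Eventually.of_forall fun y => ?_)
      simp only [Pi.add_apply]
      ring
    refine ⟨hmeas, ?_⟩
    refine HasFiniteIntegral.mono' (g := fun y => |χ y| * (‖fderiv ℝ U y‖ * ‖curl U y‖ ^ q))
      (((hχcont.abs.mul (hDUc.norm.mul hωq)).integrable_of_hasCompactSupport
        hχc.norm.mul_right).hasFiniteIntegral) (Eventually.of_forall fun y => ?_)
    rw [Real.norm_eq_abs, abs_mul, abs_mul]
    refine mul_le_mul_of_nonneg_left ?_ (abs_nonneg _)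
    by_cases hω : curl U y = 0
    · simp [hω, Real.zero_rpow hq.ne']
    · rw [abs_of_nonneg (Real.rpow_nonneg (norm_nonneg _) _)]
      have hpos : 0 < ‖curl U y‖ := norm_pos_iff.2 hω
      calc ‖curl U y‖ ^ (q - 2) * |⟪fderiv ℝ U y (curl U y), curl U y⟫|
          ≤ ‖curl U y‖ ^ (q - 2) * (‖fderiv ℝ U y‖ * ‖curl U y‖ * ‖curl U y‖) := by
            refine mul_le_mul_of_nonneg_left ((abs_real_inner_le_norm _ _).trans ?_)
              (Real.rpow_nonneg hpos.le _)
            exact mul_le_mul_of_nonneg_right (ContinuousLinearMap.le_opNorm _ _) (norm_nonneg _)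
        _ = ‖fderiv ℝ U y‖ * (‖curl U y‖ ^ (q - 2) * ‖curl U y‖ ^ (2 : ℝ)) := by
            rw [Real.rpow_two]; ring
        _ = ‖fderiv ℝ U y‖ * ‖curl U y‖ ^ q := by
            rw [← Real.rpow_add hpos]; congr 2; ring
  have eL : ∫ y, (χ y * (‖curl U y‖ ^ (q - 2) * ⟪fderiv ℝ U y (curl U y), curl U y⟫ -
      ‖curl U y‖ ^ q)) = (∫ y, χ y * (‖curl U y‖ ^ (q - 2) *
        ⟪fderiv ℝ U y (curl U y), curl U y⟫)) - ∫ y, χ y * ‖curl U y‖ ^ q := by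
    rw [← integral_sub hiL3 hiL1]
    refine integral_congr_ae (Eventually.of_forall fun y => ?_)
    simp only
    ring
  have eR : ∫ y, ‖curl U y‖ ^ q * ((3 * γ) * χ y + fderiv ℝ χ y (selfSimilarTransport γ c U y)) =
      (3 * γ) * (∫ y, χ y * ‖curl U y‖ ^ q) +
        ∫ y, ‖curl U y‖ ^ q * fderiv ℝ χ y (selfSimilarTransport γ c U y) := by
    have e : (fun y => ‖curl U y‖ ^ q * ((3 * γ) * χ y +
        fderiv ℝ χ y (selfSimilarTransport γ c U y))) = fun y =>
        (3 * γ) * (χ y * ‖curl U y‖ ^ q) +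
          ‖curl U y‖ ^ q * fderiv ℝ χ y (selfSimilarTransport γ c U y) := by
      funext y; ring
    rw [e, integral_add (hiL1.const_mul _) hiL2, integral_const_mul]
  rw [eL, eR] at heq
  linarith

end Literature.Analysis.FluidPDE
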